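/-
Copyright (c) 2026. All rights reserved.
Released under Apache 2.0 license as described in the file LICENSE.
-/
import Literature.AlgebraicGeometry.Pohlmann1968.CMTypeRankRegularRepresentationNumberField
import Literature.NumberTheory.ComplexMultiplication.CMTypeRankMurtyBound
import HarnessLib

/-!
# Murty's bound for a primitive CM type of a normal number field: `(p − 1)² · v_p([K : ℚ]) ≤ p · rank(K; Φ)`

Number-field dress of `NumberTheory/ComplexMultiplication/CMTypeRankMurtyBound` (L. Mai, *Lower bounds for the ranks
of CM types*, J. Number Theory 32 (1989) §2 Prop. 2, due to Murty — PROVED there for a finite group `G` permuting the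
translates of `Φ` faithfully, in the integer form `(p − 1)² · v_p(|G|) ≤ p · rank(Φ)`) on the carriers of
`Pohlmann1968/NondegenerateCMTypeDivisorClasses` (`cmTypeRank Φ` for `Φ : Motives.CMType K`, `Aut(ℂ)` acting on
`Hom(K, ℂ)`), through the left-translation dictionary of `Pohlmann1968/CMTypeRankRegularRepresentationNumberField`
(`cmTypeRank_eq_typeRank_gal_left`: `rank(K; Φ) = rank_G(S)`, `S = {g | φ₀ ∘ g ∈ Φ} ⊆ G = Gal(K/ℚ)`):

> "PROPOSITION 2.  Let `K/ℚ` be a Galois extension, with `G = Gal(K/ℚ)`, `(K, S)` be a simple CM type.  Then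
> `rank(K, S) ≥ max_p {(p − 1)² α / p : p odd prime and p^α ∥ [K : ℚ]/2}`."  [Mai1989, §2, p. 195]

* `eq_one_of_forall_mul_mem_iff_of_isPrimitive` — for `Φ` PRIMITIVE (the tree's `IsPrimitive (ℂ ≃+* ℂ) Φ.1 φ₀`:
  the translates separate the embeddings; = `(K, S)` simple) Mai's `S` has trivial stabiliser under right
  translation in `G`.
* **`sq_mul_padicValNat_finrank_le_mul_cmTypeRank`** — `(p − 1)² · v_p([K : ℚ]) ≤ p · cmTypeRank Φ` for every odd
  prime `p` (`K/ℚ` normal, `Φ` primitive); since `v_p([K:ℚ]) = v_p([K:ℚ]/2) = α` for odd `p` this is Mai's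
  `rank(K, S) ≥ (p − 1)² α / p`.

Theorems only; no definition, no named fact.  NOT here: non-normal `K` (Murty's bound with the Galois group of the
Galois closure, available abstractly as `sq_mul_padicValNat_card_le_mul_typeRank_of_isPrimitive`).

## References

* [Mai1989] L. Mai, *Lower bounds for the ranks of CM types*, J. Number Theory 32 (1989), §2 Prop. 2.
* [Gordon1999HodgeAVSurvey] B. B. Gordon, *A survey of the Hodge conjecture for abelian varieties*, §9.4.4.
* [Shimura1998] G. Shimura, *Abelian Varieties with Complex Multiplication and Modular Functions*, §8.1, §8.2 Prop. 26.
-/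

noncomputable section

open NumberField

namespace Literature.AlgebraicGeometry.Pohlmann1968

open Literature.NumberTheory.ComplexMultiplication
open Literature.AlgebraicGeometry.Motives (CMType)

open scoped Classical

variable {K : Type} [Field K] [NumberField K] [Normal ℚ K]

/-- **A primitive type is stable under no non-trivial Galois automorphism.**  For `K/ℚ` normal, `Φ` primitive
(the tree's `IsPrimitive (ℂ ≃+* ℂ) Φ.1 φ₀`: by `isPrimitive_iff_forall_eq`, the `Aut(ℂ)`-translates of `Φ` separate
the embeddings) and `S = {g ∈ Gal(K/ℚ) | φ₀ ∘ g ∈ Φ}` (`= {g | embOf φ₀ g⁻¹ ∈ Φ}`, `embOf φ₀ g = φ₀ ∘ g⁻¹`): if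
`k g ∈ S ↔ k ∈ S` for all `k` — i.e. `{φ ∘ g | φ ∈ Φ} = Φ`, `Φ` would be induced from the fixed field of `g` — then
`g = 1`.  This is the simplicity hypothesis of Mai's Propositions 1–2 in the tree's conventions: "By [7], `(K, S)`
is simple if and only if `H = {g ∈ G : g S̃ = S̃}`" (here `L = K`, `H = {1}`); Shimura: "`(F; {φᵢ})` is primitive
if and only if `H₁ = H'`". [cite: Mai1989, §1 (p. 192)] [cite: Shimura1998, §8.2 Prop. 26] -/
theorem eq_one_of_forall_mul_mem_iff_of_isPrimitive (Φ : CMType K) (φ₀ : K →+* ℂ)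
    (hprim : IsPrimitive (ℂ ≃+* ℂ) Φ.1 φ₀) (g : K ≃ₐ[ℚ] K)
    (hg : ∀ k : K ≃ₐ[ℚ] K, k * g ∈ ({g : K ≃ₐ[ℚ] K | embOf φ₀ g⁻¹ ∈ Φ.1} : Set (K ≃ₐ[ℚ] K)) ↔
      k ∈ ({g : K ≃ₐ[ℚ] K | embOf φ₀ g⁻¹ ∈ Φ.1} : Set (K ≃ₐ[ℚ] K))) :
    g = 1 := by
  haveI := isPretransitive_ringEquiv_complex (K := K)
  have hsep := (isPrimitive_iff_forall_eq Φ.1 φ₀).1 hprim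
  have h1 : embOf φ₀ g⁻¹ = embOf φ₀ 1 := by
    refine hsep (embOf φ₀ g⁻¹) (embOf φ₀ 1) fun τ => ?_
    obtain ⟨γ, hγ⟩ := exists_algEquiv_comp_eq_smul φ₀ τ
    rw [smul_embOf_of_comp φ₀ hγ, smul_embOf_of_comp φ₀ hγ, one_mul, ← mul_inv_rev]
    have := hg γ
    simp only [Set.mem_setOf_eq] at this
    exact this
  have h2 := (embOf_bijective φ₀).1 h1
  exact inv_eq_one.1 h2

/-- **Mai 1989, Proposition 2 (Murty's bound), for a normal number field `K` and a primitive `Φ`.**  For every odd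
prime `p`: `(p − 1)² · v_p([K : ℚ]) ≤ p · rank(K; Φ)` — Mai's "`rank(K, S) ≥ (p − 1)² α / p` for `p^α ∥ [K:ℚ]/2`"
(`v_p([K:ℚ]/2) = v_p([K:ℚ])` for odd `p`), proved by `Gal(K/ℚ) ↪ GL_r(𝔽_q)` for a prime `q ≡` primitive root
`(mod p²)`. [cite: Mai1989, §2 Prop. 2] [cite: Gordon1999HodgeAVSurvey, §9.4.4 (Proposition [B.72] Prop. 2)] -/
theorem sq_mul_padicValNat_finrank_le_mul_cmTypeRank (Φ : CMType K) (φ₀ : K →+* ℂ)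
    (hprim : IsPrimitive (ℂ ≃+* ℂ) Φ.1 φ₀) {p : ℕ} (hp : p.Prime) (hp2 : p ≠ 2) :
    (p - 1) ^ 2 * padicValNat p (Module.finrank ℚ K) ≤ p * cmTypeRank Φ := by
  have hcard : Fintype.card (K ≃ₐ[ℚ] K) = Module.finrank ℚ K := by
    rw [Fintype.card_congr (Equiv.ofBijective (embOf φ₀) (embOf_bijective φ₀))]
    exact NumberField.Embeddings.card K ℂ
  rw [cmTypeRank_eq_typeRank_gal_left Φ φ₀, ← hcard]
  exact sq_mul_padicValNat_card_le_mul_typeRank_of_forall_mul_mem_iff _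
    (fun g hg => eq_one_of_forall_mul_mem_iff_of_isPrimitive Φ φ₀ hprim g hg) hp hp2

end Literature.AlgebraicGeometry.Pohlmann1968

end
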